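import Summits.BirchSwinnertonDyer.BirchSwinnertonDyer.Theorems.Rank1ResidualJetCarrierNeRows
import Summits.BirchSwinnertonDyer.BirchSwinnertonDyer.Theorems.Rank1ResidualJetCarrierMult
import Summits.BirchSwinnertonDyer.BirchSwinnertonDyer.Theorems.Rank1ResidualIntModelReduction
import Summits.BirchSwinnertonDyer.Rank1Residual.Supersingular.SurjFrobeniusOrderCertificateShape
import Summits.BirchSwinnertonDyer.Rank1Residual.Additive.IntModelTamagawaCertificateLocal
import HarnessLib

/-!
# T1 JET (cell `bsd-jet`), road «R-IDX»: the RECORD KIT that turns a two-engine HEEGNER-INDEX row into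
# `BSD(E,p)` BY NAME through the bucket-A / bucket-B READING binders — `ρ̄_{E,p}` onto and `c_q` IN THE KERNEL

HONEST FRAMING (programme `BSD-LIT2PART-PROGRAMME-v1.md` §HONESTY, verbatim): «no tranche here proves BSD;
ARM L moves the LITERAL column of an r ≤ 1 census into the kernel-proved-modulo-named-print column; ARM P
changes what «named print» is worth. The residue (4.31 %) and every SUMMIT-BEARING rung (S0–S3) stay
theorem-bound and are staffed by the 22 routes, not by this programme.» THEOREMS ONLY (no definition, no
named fact, no `sorry`); PER PAIR; nothing is booked by this file; what a record through this kit is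
worth is the referees' word on the READING binders `hJ` (typed targets `JET.JetchevDivisibilityCarrierNe`
— seat `bsd-jet-pv-1`, p459625, audit sheet `HOME/sheets/PV1-A-BLOCK-READING.md` — and
`JET.JetchevDivisibilityCarrierMult` — seat `bsd-jet-pv-2`, p463660, sheet `HOME/sheets/PV2-B-GAP.md`)
and on a two-engine index line (cell plan `HOME/JET-PLAN.md`, decision point «ROAD R-IDX»). Seat
`bsd-jet-ty` (typer), generator `HOME/staging/bsd-jet-ty/tools/gen_jet_ridx_records.py`.

WHAT THIS FILE IS. The twin of the contingency kit `JET/IndexTamagawaRecordsKitSurj.lean` (p464673: Miller 2011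
Thm. 5.4, ONE flagged binder `hMS`) with the class-free consumer REPLACED by the provers' reading-conditional
consumers `JET.bsdp_of_carrierNeCertificate_level_of_five_le` / `…_of_mult` (bucket A, `q ≠ p`, p462126) and
`JET.bsdp_of_carrierMultCertificate_level_of_surj` (bucket B, `q = p`, p464096), and of their record kits
(p463005 / p465088) with the Tamagawa half moved INTO THE KERNEL, so that the DISPLAYED certificate of a
record is the pure index line `hv : ord_p [E(K):ℤP] ≤ w` (two index engines) — the row shape of the cell's
D1-IDX (p462294) and CJ records:
* §1 (`p ≥ 5`, ANY reduction at `p` on the A side; the 81 237 `p ≥ 5` pairs of `HOME/jet_rows.tsv`, all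
  but 54 with `ρ̄_{E,p}` onto, every one with exactly ONE carrier): `bsdp_of_jetRowA5_tam_min` (bucket A:
  carrier `q ≠ p` split multiplicative, `p ∣ c_q`) and `bsdp_of_jetRowB5_tam_min` (bucket B: carrier
  `q = p`, split `I_n`, `p ∣ n`) — image by THREE Serre Prop-19 witnesses (prover B's
  `Supersingular.surj_of_ainvs_of_serreWitnesses`), `c_q(W/ℚ_q) = c` from ONE `TamLocal` certificate
  (n1011-p03's bridge `Additive.IntModelTam.localTamagawaNumber_padic_eq_of_intModel_of_tamLocal`);
* §2 (`p = 3` MULTIPLICATIVE at `3`; the additive-at-`3` rows are road C3's): `bsdp_of_jetRowA3_tam_min`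
  (carrier `q ≠ 3` split multiplicative), `bsdp_of_jetRowA3_tamX_min` (carrier `q ≠ 3` of type `IV`/`IV*`,
  `c_q = 3`, exact `TamX` certificate), `bsdp_of_jetRowB3_tam_min` (carrier `3`, split `I_{3k}`) — image by
  an irreducible Frobenius and a transvection of order `3` (prover B's
  `Supersingular.surj_three_of_ainvs_of_irr_of_order`), the `3`-adic tower by the Tate line inside the
  consumers.
Kernel inputs per record (`decide` / `norm_num` goals): global minimality of the literal model (`hmin`),
the image witnesses with schema point counts, the Tamagawa certificate, `w ≤ ord_p c`, and at a
multiplicative `p` the pair `p ∣ Δ`, `p ∤ c₄`. DISPLAYED per record: `hJ` (READING), the published `hMcU`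
(McCallum 1991 Cor. 5.6), `hGZK`, `hKo`, `hrec`, `hD36`, `hlev`; the Heegner datum (`K` imaginary quadratic,
`d_K ∉ {−3, −4}`, Heegner hypothesis for the level `N`, `P` a Heegner point of infinite order), `q ∣ N`, the
INDEX LINE `hv`, `r_an ≤ 1`, `#Ш_an = s` with `ord_p s = 0`. No `p ∤ d_K`, no `p² ∤ N`, no `¬CM`. Nothing
about any particular curve is asserted. PARTITION: row D5 `JET@p∣N` — 0 classes moved by this file.

References: D. Jetchev, Compos. Math. 144 (2008) Thm. 1.4, Cor. 1.5 (p. 812) [Jetchev2008]; W. McCallum,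
in *L-functions and Arithmetic* (1991) Cor. 5.6 [McCallum1991]; J.-P. Serre, Invent. Math. 15 (1972)
§2.4 Prop. 15, §2.8 Prop. 19 [Serre1972]; C. Wuthrich, Doc. Math. 19 (2014) Lemma 20 [Wuthrich2014];
J. H. Silverman, *AEC* (2009) VII.5 Prop. 5.1(b) [SilvermanAEC2009], *ATAEC* (1994) IV.9.4
[SilvermanATAEC1994]; Diamond–Shurman (2005) Thm. 8.8.1 [DiamondShurman2005]; Miller (2011) Def. 1.1 [Miller2011LMS].
-/

set_option autoImplicit false

noncomputable section

open scoped Classical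

open WeierstrassCurve Literature.NumberTheory.EllipticCurves
  Literature.NumberTheory.EllipticCurves.ModularForms
  Literature.NumberTheory.EllipticCurves.Rank1Residual
  Literature.NumberTheory.EllipticCurves.Rank1Residual.Typed
  Literature.NumberTheory.EllipticCurves.Rank1Residual.X11RankOneCertificates
  Summit.BirchSwinnertonDyer.BirchSwinnertonDyer.Rank1Residual
  Summit.BirchSwinnertonDyer.BirchSwinnertonDyer.Rank1Residual.IntModel
  Summit.BirchSwinnertonDyer.BirchSwinnertonDyer.Rank1Residual.X11RankOne
  Summit.BirchSwinnertonDyer.BirchSwinnertonDyer.Rank2Observatory.Tam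
  Summit.BirchSwinnertonDyer.Rank1Residual Summit.BirchSwinnertonDyer.Rank1Residual.X11b

namespace Summit.BirchSwinnertonDyer.Rank1Residual.JET

/-! ## §1 `p ≥ 5`: image by three Serre witnesses, `c_q` by a `TamLocal` certificate -/
/-- **Bucket A, `p ≥ 5` (ANY reduction at `p`): `BSD(E,p)` for a literal integer model from the two-engine
HEEGNER-INDEX line `ord_p [E(K):ℤP] ≤ w` through the bucket-A reading binder, with `ρ̄_{E,p}` ONTO and the
Tamagawa exponent `w ≤ ord_p c_q(E)` at the carrier `q ≠ p` CHECKED IN THE KERNEL.** Inputs: (kernel) `hmin`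
global minimality of the literal model; THREE Serre Prop-19 witnesses (odd good `ℓᵢ ≠ p`, schema counts
`countPoints [a] ℓᵢ = nᵢ`, `aᵢ = ℓᵢ + 1 − nᵢ`; (i) `a₁² − 4ℓ₁ = r² ≠ 0`, `a₁ ≠ 0`; (ii)
`(a₂² − 4ℓ₂)^{(p−1)/2} = −1`, `a₂ ≠ 0`; (iii) `a₃² = uℓ₃`, `u ∉ {0,1,2,4}`, `u² − 3u + 1 ≠ 0`, in `ZMod p`);
ONE stage-1 Tamagawa certificate `T : TamLocal` at `q = T.p` with singleton value set `[c]`, `w ≤ ord_p c`,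
`q ≠ p`; (binders, displayed) the READING `hJ : JetchevDivisibilityCarrierNe`, the published `hMcU`, `hGZK`,
`hKo`, `hrec`, `hD36`, `hlev`, the Heegner datum (`K` with `d_K ∉ {−3,−4}`, Heegner hypothesis for `N`, `P`
of infinite order), `q ∣ N`, the INDEX LINE `hv : ord_p [E(K):ℤP] ≤ w`, `r_an ≤ 1`, `#Ш_an = s` with
`ord_p s = 0`. Output via `JET.bsdp_of_carrierNeCertificate_level_of_five_le` (tower by Serre IV-23).
CONDITIONAL on every binder; per pair; no class statement. [cite: Jetchev2008, Cor. 1.5 (p. 812)]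
[cite: Serre1972, §2.8 Prop. 19 and §5.2 (iii)] [cite: SilvermanATAEC1994, IV.9.4 and Cor. IV.9.2(d)]
[cite: Miller2011LMS, Def. 1.1] -/
theorem bsdp_of_jetRowA5_tam_min (p : ℕ) (hp : p.Prime) (hp5 : 5 ≤ p) (a1 a2 a3 a4 a6 : ℤ)
    (hmin : (⟨a1, a2, a3, a4, a6⟩ : WeierstrassCurve ℚ).IsGloballyMinimal)
    (ℓ₁ ℓ₂ ℓ₃ : ℕ) (hℓ₁ : ℓ₁.Prime) (hℓ₂ : ℓ₂.Prime) (hℓ₃ : ℓ₃.Prime)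
    (h2₁ : ℓ₁ ≠ 2) (h2₂ : ℓ₂ ≠ 2) (h2₃ : ℓ₃ ≠ 2) (hne₁ : ℓ₁ ≠ p) (hne₂ : ℓ₂ ≠ p) (hne₃ : ℓ₃ ≠ p)
    (hΔ₁ : ¬ (ℓ₁ : ℤ) ∣ discOf [a1, a2, a3, a4, a6]) (hΔ₂ : ¬ (ℓ₂ : ℤ) ∣ discOf [a1, a2, a3, a4, a6])
    (hΔ₃ : ¬ (ℓ₃ : ℤ) ∣ discOf [a1, a2, a3, a4, a6])
    {n₁ n₂ n₃ : ℕ} (hc₁ : countPoints [a1, a2, a3, a4, a6] ℓ₁ = n₁)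
    (hc₂ : countPoints [a1, a2, a3, a4, a6] ℓ₂ = n₂) (hc₃ : countPoints [a1, a2, a3, a4, a6] ℓ₃ = n₃)
    (r u : ZMod p)
    (hi : (((ℓ₁ : ℤ) + 1 - n₁ : ℤ) : ZMod p) ^ 2 - 4 * ℓ₁ = r * r ∧
      (((ℓ₁ : ℤ) + 1 - n₁ : ℤ) : ZMod p) ^ 2 - 4 * ℓ₁ ≠ 0 ∧ (((ℓ₁ : ℤ) + 1 - n₁ : ℤ) : ZMod p) ≠ 0)
    (hii : ((((ℓ₂ : ℤ) + 1 - n₂ : ℤ) : ZMod p) ^ 2 - 4 * ℓ₂) ^ (p / 2) = -1 ∧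
      (((ℓ₂ : ℤ) + 1 - n₂ : ℤ) : ZMod p) ≠ 0)
    (hiii : (((ℓ₃ : ℤ) + 1 - n₃ : ℤ) : ZMod p) ^ 2 = u * ℓ₃ ∧
      u ≠ 0 ∧ u ≠ 1 ∧ u ≠ 2 ∧ u ≠ 4 ∧ u ^ 2 - 3 * u + 1 ≠ 0)
    (q : ℕ) (T : TamLocal) (hTq : T.p = q) (hT : T.check ⟨a1, a2, a3, a4, a6⟩ = true)
    {c : ℕ} (hvals : T.vals = [c]) {w : ℕ} (hw : w ≤ padicValNat p c) (hqp : q ≠ p)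
    (hJ : JetchevDivisibilityCarrierNe)
    (hMcU : McCallum1991_padicValNat_card_sha_primary_add_le_of_globalDivisibility)
    (hGZK : rank_eq_analyticRank_of_analyticRank_le_one)
    (hKo : ∀ (N : ℕ) [NeZero N] (W : WeierstrassCurve ℚ) (K : Type) [Field K] [NumberField K], kolyvagin N W K)
    (hrec : ∀ (N : ℕ) [NeZero N] (W : WeierstrassCurve ℚ) (K : Type) [Field K] [NumberField K],
      heegnerPointOfConductor_one_galoisConj N W K)
    (hD36 : ∀ (N : ℕ) [NeZero N] (W : WeierstrassCurve ℚ) (K : Type) [Field K] [NumberField K],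
      phi_heegnerTau_mem_singularModuliField N W K)
    (hlev : ∀ {N : ℕ} [NeZero N], IsNewformOf.level_eq_conductorNorm (N := N))
    (W : WeierstrassCurve ℚ) (hW : W = ⟨a1, a2, a3, a4, a6⟩)
    {N : ℕ} [NeZero N] {K : Type} [Field K] [NumberField K] (hK : IsImaginaryQuadratic K)
    (hD3 : NumberField.discr K ≠ -3) (hD4 : NumberField.discr K ≠ -4)
    (hH : SatisfiesHeegnerHypothesis N K) {P : (W.baseChange K).toAffine.Point}
    (hP : IsHeegnerPoint N W K P) (hnt : ¬ IsOfFinAddOrder P) (hqN : q ∣ N)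
    (hv : padicValNat p (AddSubgroup.zmultiples P).index ≤ w)
    (hr : W.analyticRank ≤ 1) {s : ℚ} (hs : shaAn W = (s : ℂ)) (hvs : padicValRat p s = 0) :
    BSDp W p := by
  subst hW
  have h0 : discOf [a1, a2, a3, a4, a6] ≠ 0 := fun h ↦ hΔ₁ (by rw [h]; exact dvd_zero _)
  haveI hE : (⟨a1, a2, a3, a4, a6⟩ : WeierstrassCurve ℚ).IsElliptic :=
    X11b.isElliptic_of_discOf_ne_zero a1 a2 a3 a4 a6 h0
  haveI := hmin
  haveI : Fact (Nat.Prime p) := ⟨hp⟩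
  haveI : Fact (Nat.Prime q) := ⟨hTq ▸ (TamLocal.check_common hT).1⟩
  have hI0 : integralModelInt (⟨a1, a2, a3, a4, a6⟩ : WeierstrassCurve ℚ) = ⟨a1, a2, a3, a4, a6⟩ :=
    integralModelInt_eq_of_map_eq _ (map_mk_int a1 a2 a3 a4 a6)
  -- `ρ̄_{E,p}` onto from the three Serre witnesses (Serre 1972 Prop. 19)
  have hρ : Surj (⟨a1, a2, a3, a4, a6⟩ : WeierstrassCurve ℚ) p :=
    Supersingular.surj_of_ainvs_of_serreWitnesses a1 a2 a3 a4 a6 p hp5 hmin ℓ₁ ℓ₂ ℓ₃ hℓ₁ hℓ₂ hℓ₃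
      h2₁ h2₂ h2₃ hne₁ hne₂ hne₃ hΔ₁ hΔ₂ hΔ₃ hc₁ hc₂ hc₃ r u hi hii hiii
  -- the Tamagawa half in the kernel: `c_q(W/ℚ_q) = c`
  have hcq : ((⟨a1, a2, a3, a4, a6⟩ : WeierstrassCurve ℚ).baseChange ℚ_[q]).localTamagawaNumber ℤ_[q] = c :=
    Additive.IntModelTam.localTamagawaNumber_padic_eq_of_intModel_of_tamLocal hI0 q hTq hT hvals
  have hI : padicValNat p (AddSubgroup.zmultiples P).index ≤ padicValNat p
      (((⟨a1, a2, a3, a4, a6⟩ : WeierstrassCurve ℚ).baseChange ℚ_[q]).localTamagawaNumber ℤ_[q]) := hcq ▸ hv.trans hw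
  exact bsdp_of_carrierNeCertificate_level_of_five_le hJ hMcU hGZK hKo hrec hD36 hlev _ p hK hD3 hD4 hH hP
    hnt hp5 hρ q hqN hqp hI hr hs hvs

/-- **Bucket B, `p ≥ 5` (carrier `q = p`, split `I_n` with `p ∣ n`): `BSD(E,p)` for a literal integer model
from the two-engine HEEGNER-INDEX line `ord_p [E(K):ℤP] ≤ w` through the bucket-B reading binder, with
`ρ̄_{E,p}` ONTO, `p` MULTIPLICATIVE and `w ≤ ord_p c_p(E)` CHECKED IN THE KERNEL.** Inputs as in
`bsdp_of_jetRowA5_tam_min` with the `TamLocal` certificate AT `p` and, in addition, `p ∣ Δ`, `p ∤ c₄` of the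
literal model (multiplicative at `p`; the `p`-adic tower is discharged inside the consumer by the Tate line);
displayed binders: the READING `hJ : JetchevDivisibilityCarrierMult` and the rest as in the A theorem (no
`q`, the carrier is `p`; `p ∣ N`). Output via `JET.bsdp_of_carrierMultCertificate_level_of_surj`.
CONDITIONAL on every binder; per pair; no class statement. [cite: Jetchev2008, Cor. 1.5 (p. 812)]
[cite: Serre1972, §2.8 Prop. 19 and §5.2 (iii)] [cite: SilvermanAEC2009, VII.5 Prop. 5.1(b)]
[cite: SilvermanATAEC1994, IV.9.4] [cite: Wuthrich2014, Lemma 20 (p. 399)] [cite: Miller2011LMS, Def. 1.1] -/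
theorem bsdp_of_jetRowB5_tam_min (p : ℕ) (hp : p.Prime) (hp5 : 5 ≤ p) (a1 a2 a3 a4 a6 : ℤ)
    (hmin : (⟨a1, a2, a3, a4, a6⟩ : WeierstrassCurve ℚ).IsGloballyMinimal)
    (hpΔ : (p : ℤ) ∣ (⟨a1, a2, a3, a4, a6⟩ : WeierstrassCurve ℤ).Δ)
    (hpc₄ : ¬ (p : ℤ) ∣ (⟨a1, a2, a3, a4, a6⟩ : WeierstrassCurve ℤ).c₄)
    (ℓ₁ ℓ₂ ℓ₃ : ℕ) (hℓ₁ : ℓ₁.Prime) (hℓ₂ : ℓ₂.Prime) (hℓ₃ : ℓ₃.Prime)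
    (h2₁ : ℓ₁ ≠ 2) (h2₂ : ℓ₂ ≠ 2) (h2₃ : ℓ₃ ≠ 2) (hne₁ : ℓ₁ ≠ p) (hne₂ : ℓ₂ ≠ p) (hne₃ : ℓ₃ ≠ p)
    (hΔ₁ : ¬ (ℓ₁ : ℤ) ∣ discOf [a1, a2, a3, a4, a6]) (hΔ₂ : ¬ (ℓ₂ : ℤ) ∣ discOf [a1, a2, a3, a4, a6])
    (hΔ₃ : ¬ (ℓ₃ : ℤ) ∣ discOf [a1, a2, a3, a4, a6])
    {n₁ n₂ n₃ : ℕ} (hc₁ : countPoints [a1, a2, a3, a4, a6] ℓ₁ = n₁)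
    (hc₂ : countPoints [a1, a2, a3, a4, a6] ℓ₂ = n₂) (hc₃ : countPoints [a1, a2, a3, a4, a6] ℓ₃ = n₃)
    (r u : ZMod p)
    (hi : (((ℓ₁ : ℤ) + 1 - n₁ : ℤ) : ZMod p) ^ 2 - 4 * ℓ₁ = r * r ∧
      (((ℓ₁ : ℤ) + 1 - n₁ : ℤ) : ZMod p) ^ 2 - 4 * ℓ₁ ≠ 0 ∧ (((ℓ₁ : ℤ) + 1 - n₁ : ℤ) : ZMod p) ≠ 0)
    (hii : ((((ℓ₂ : ℤ) + 1 - n₂ : ℤ) : ZMod p) ^ 2 - 4 * ℓ₂) ^ (p / 2) = -1 ∧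
      (((ℓ₂ : ℤ) + 1 - n₂ : ℤ) : ZMod p) ≠ 0)
    (hiii : (((ℓ₃ : ℤ) + 1 - n₃ : ℤ) : ZMod p) ^ 2 = u * ℓ₃ ∧
      u ≠ 0 ∧ u ≠ 1 ∧ u ≠ 2 ∧ u ≠ 4 ∧ u ^ 2 - 3 * u + 1 ≠ 0)
    (T : TamLocal) (hTp : T.p = p) (hT : T.check ⟨a1, a2, a3, a4, a6⟩ = true)
    {c : ℕ} (hvals : T.vals = [c]) {w : ℕ} (hw : w ≤ padicValNat p c)
    (hJ : JetchevDivisibilityCarrierMult)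
    (hMcU : McCallum1991_padicValNat_card_sha_primary_add_le_of_globalDivisibility)
    (hGZK : rank_eq_analyticRank_of_analyticRank_le_one)
    (hKo : ∀ (N : ℕ) [NeZero N] (W : WeierstrassCurve ℚ) (K : Type) [Field K] [NumberField K], kolyvagin N W K)
    (hrec : ∀ (N : ℕ) [NeZero N] (W : WeierstrassCurve ℚ) (K : Type) [Field K] [NumberField K],
      heegnerPointOfConductor_one_galoisConj N W K)
    (hD36 : ∀ (N : ℕ) [NeZero N] (W : WeierstrassCurve ℚ) (K : Type) [Field K] [NumberField K],
      phi_heegnerTau_mem_singularModuliField N W K)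
    (hlev : ∀ {N : ℕ} [NeZero N], IsNewformOf.level_eq_conductorNorm (N := N))
    (W : WeierstrassCurve ℚ) (hW : W = ⟨a1, a2, a3, a4, a6⟩)
    {N : ℕ} [NeZero N] {K : Type} [Field K] [NumberField K] (hK : IsImaginaryQuadratic K)
    (hD3 : NumberField.discr K ≠ -3) (hD4 : NumberField.discr K ≠ -4)
    (hH : SatisfiesHeegnerHypothesis N K) {P : (W.baseChange K).toAffine.Point}
    (hP : IsHeegnerPoint N W K P) (hnt : ¬ IsOfFinAddOrder P)
    (hv : padicValNat p (AddSubgroup.zmultiples P).index ≤ w)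
    (hr : W.analyticRank ≤ 1) {s : ℚ} (hs : shaAn W = (s : ℂ)) (hvs : padicValRat p s = 0) :
    BSDp W p := by
  subst hW
  have h0 : discOf [a1, a2, a3, a4, a6] ≠ 0 := fun h ↦ hΔ₁ (by rw [h]; exact dvd_zero _)
  haveI hE : (⟨a1, a2, a3, a4, a6⟩ : WeierstrassCurve ℚ).IsElliptic :=
    X11b.isElliptic_of_discOf_ne_zero a1 a2 a3 a4 a6 h0
  haveI := hmin
  haveI : Fact (Nat.Prime p) := ⟨hp⟩
  have hI0 : integralModelInt (⟨a1, a2, a3, a4, a6⟩ : WeierstrassCurve ℚ) = ⟨a1, a2, a3, a4, a6⟩ :=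
    integralModelInt_eq_of_map_eq _ (map_mk_int a1 a2 a3 a4 a6)
  -- `ρ̄_{E,p}` onto from the three Serre witnesses (Serre 1972 Prop. 19)
  have hρ : Surj (⟨a1, a2, a3, a4, a6⟩ : WeierstrassCurve ℚ) p :=
    Supersingular.surj_of_ainvs_of_serreWitnesses a1 a2 a3 a4 a6 p hp5 hmin ℓ₁ ℓ₂ ℓ₃ hℓ₁ hℓ₂ hℓ₃
      h2₁ h2₂ h2₃ hne₁ hne₂ hne₃ hΔ₁ hΔ₂ hΔ₃ hc₁ hc₂ hc₃ r u hi hii hiii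
  -- multiplicative at the carrier `p`
  have hmult : (⟨a1, a2, a3, a4, a6⟩ : WeierstrassCurve ℚ).HasMultiplicativeReductionAtPrime p :=
    hasMultiplicativeReductionAtPrime_of_intModel hI0 p hpΔ hpc₄
  -- the Tamagawa half in the kernel: `c_p(W/ℚ_p) = c`
  have hcp : ((⟨a1, a2, a3, a4, a6⟩ : WeierstrassCurve ℚ).baseChange ℚ_[p]).localTamagawaNumber ℤ_[p] = c :=
    Additive.IntModelTam.localTamagawaNumber_padic_eq_of_intModel_of_tamLocal hI0 p hTp hT hvals
  have hI : padicValNat p (AddSubgroup.zmultiples P).index ≤ padicValNat p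
      (((⟨a1, a2, a3, a4, a6⟩ : WeierstrassCurve ℚ).baseChange ℚ_[p]).localTamagawaNumber ℤ_[p]) := hcp ▸ hv.trans hw
  exact bsdp_of_carrierMultCertificate_level_of_surj hJ hMcU hGZK hKo hrec hD36 hlev _ p hK hD3 hD4 hH hP
    hnt (by omega) hmult hρ hI hr hs hvs

/-! ## §2 `p = 3` multiplicative at `3`: image by an irreducible Frobenius and a transvection of order `3` -/
/-- **Bucket A, `p = 3 ∥ N` (MULTIPLICATIVE at `3`), carrier `q ≠ 3` split multiplicative: `BSD(E,3)` for a
literal integer model from the two-engine HEEGNER-INDEX line `ord₃ [E(K):ℤP] ≤ w` through the bucket-A reading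
binder, with `ρ̄_{E,3}` ONTO, `3` multiplicative and `w ≤ ord₃ c_q(E)` CHECKED IN THE KERNEL.** Kernel inputs:
`hmin`; `3 ∣ Δ`, `3 ∤ c₄` (multiplicative at `3`: the `3`-adic tower follows from `ρ̄_{E,3}` onto by the Tate
line inside `JET.bsdp_of_carrierNeCertificate_level_of_mult`); TWO Frobenius witnesses at odd good `ℓ₁, ℓ₂ ≠ 3`:
(i) `X² − a₁X + ℓ₁` irreducible mod `3`; (ii) `ℓ₂ ≡ 1`, `a₂ ≡ 2 (mod 3)`, `9 ∤ n₂` (a transvection of order `3`);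
ONE `TamLocal` certificate at `q = T.p`, value set `[c]`, `w ≤ ord₃ c`, `q ≠ 3`; displayed binders as in
`bsdp_of_jetRowA5_tam_min`. CONDITIONAL on every binder; per pair. [cite: Jetchev2008, Cor. 1.5 (p. 812)]
[cite: Serre1972, §2.4 Prop. 15 and §5.2 (iii)] [cite: SilvermanAEC2009, VII.5 Prop. 5.1(b)]
[cite: SilvermanATAEC1994, IV.9.4] [cite: Wuthrich2014, Lemma 20 (p. 399)] [cite: Miller2011LMS, Def. 1.1] -/
theorem bsdp_of_jetRowA3_tam_min (a1 a2 a3 a4 a6 : ℤ)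
    (hmin : (⟨a1, a2, a3, a4, a6⟩ : WeierstrassCurve ℚ).IsGloballyMinimal)
    (h3Δ : (3 : ℤ) ∣ (⟨a1, a2, a3, a4, a6⟩ : WeierstrassCurve ℤ).Δ)
    (h3c₄ : ¬ (3 : ℤ) ∣ (⟨a1, a2, a3, a4, a6⟩ : WeierstrassCurve ℤ).c₄)
    (ℓ₁ ℓ₂ : ℕ) (hℓ₁ : ℓ₁.Prime) (hℓ₂ : ℓ₂.Prime) (h2₁ : ℓ₁ ≠ 2) (h2₂ : ℓ₂ ≠ 2)
    (h3₁ : ℓ₁ ≠ 3) (h3₂ : ℓ₂ ≠ 3)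
    (hΔ₁ : ¬ (ℓ₁ : ℤ) ∣ discOf [a1, a2, a3, a4, a6]) (hΔ₂ : ¬ (ℓ₂ : ℤ) ∣ discOf [a1, a2, a3, a4, a6])
    {n₁ n₂ : ℕ} (hc₁ : countPoints [a1, a2, a3, a4, a6] ℓ₁ = n₁)
    (hc₂ : countPoints [a1, a2, a3, a4, a6] ℓ₂ = n₂)
    (hirr : ∀ t : ZMod 3, t ^ 2 - (((ℓ₁ : ℤ) + 1 - n₁ : ℤ) : ZMod 3) * t + ℓ₁ ≠ 0)
    (hdet₂ : (ℓ₂ : ZMod 3) = 1) (htr₂ : (((ℓ₂ : ℤ) + 1 - n₂ : ℤ) : ZMod 3) = 2) (hsq : ¬ 9 ∣ n₂)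
    (q : ℕ) (T : TamLocal) (hTq : T.p = q) (hT : T.check ⟨a1, a2, a3, a4, a6⟩ = true)
    {c : ℕ} (hvals : T.vals = [c]) {w : ℕ} (hw : w ≤ padicValNat 3 c) (hq3 : q ≠ 3)
    (hJ : JetchevDivisibilityCarrierNe)
    (hMcU : McCallum1991_padicValNat_card_sha_primary_add_le_of_globalDivisibility)
    (hGZK : rank_eq_analyticRank_of_analyticRank_le_one)
    (hKo : ∀ (N : ℕ) [NeZero N] (W : WeierstrassCurve ℚ) (K : Type) [Field K] [NumberField K], kolyvagin N W K)
    (hrec : ∀ (N : ℕ) [NeZero N] (W : WeierstrassCurve ℚ) (K : Type) [Field K] [NumberField K],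
      heegnerPointOfConductor_one_galoisConj N W K)
    (hD36 : ∀ (N : ℕ) [NeZero N] (W : WeierstrassCurve ℚ) (K : Type) [Field K] [NumberField K],
      phi_heegnerTau_mem_singularModuliField N W K)
    (hlev : ∀ {N : ℕ} [NeZero N], IsNewformOf.level_eq_conductorNorm (N := N))
    (W : WeierstrassCurve ℚ) (hW : W = ⟨a1, a2, a3, a4, a6⟩)
    {N : ℕ} [NeZero N] {K : Type} [Field K] [NumberField K] (hK : IsImaginaryQuadratic K)
    (hD3 : NumberField.discr K ≠ -3) (hD4 : NumberField.discr K ≠ -4)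
    (hH : SatisfiesHeegnerHypothesis N K) {P : (W.baseChange K).toAffine.Point}
    (hP : IsHeegnerPoint N W K P) (hnt : ¬ IsOfFinAddOrder P) (hqN : q ∣ N)
    (hv : padicValNat 3 (AddSubgroup.zmultiples P).index ≤ w)
    (hr : W.analyticRank ≤ 1) {s : ℚ} (hs : shaAn W = (s : ℂ)) (hvs : padicValRat 3 s = 0) :
    BSDp W 3 := by
  subst hW
  have h0 : discOf [a1, a2, a3, a4, a6] ≠ 0 := fun h ↦ hΔ₁ (by rw [h]; exact dvd_zero _)
  haveI hE : (⟨a1, a2, a3, a4, a6⟩ : WeierstrassCurve ℚ).IsElliptic :=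
    X11b.isElliptic_of_discOf_ne_zero a1 a2 a3 a4 a6 h0
  haveI := hmin
  haveI : Fact (Nat.Prime 3) := ⟨by norm_num⟩
  haveI : Fact (Nat.Prime q) := ⟨hTq ▸ (TamLocal.check_common hT).1⟩
  have hI0 : integralModelInt (⟨a1, a2, a3, a4, a6⟩ : WeierstrassCurve ℚ) = ⟨a1, a2, a3, a4, a6⟩ :=
    integralModelInt_eq_of_map_eq _ (map_mk_int a1 a2 a3 a4 a6)
  -- `ρ̄_{E,3}` onto from the two Frobenius witnesses (irreducible + order 3)
  have hρ : Surj (⟨a1, a2, a3, a4, a6⟩ : WeierstrassCurve ℚ) 3 :=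
    Supersingular.surj_three_of_ainvs_of_irr_of_order a1 a2 a3 a4 a6 hmin ℓ₁ ℓ₂ hℓ₁ hℓ₂ h2₁ h2₂ h3₁ h3₂
      hΔ₁ hΔ₂ hc₁ hc₂ hirr hdet₂ htr₂ hsq
  -- multiplicative at `3`
  have hmult : (⟨a1, a2, a3, a4, a6⟩ : WeierstrassCurve ℚ).HasMultiplicativeReductionAtPrime 3 :=
    hasMultiplicativeReductionAtPrime_of_intModel hI0 3 h3Δ h3c₄
  -- the Tamagawa half in the kernel: `c_q(W/ℚ_q) = c`
  have hcq : ((⟨a1, a2, a3, a4, a6⟩ : WeierstrassCurve ℚ).baseChange ℚ_[q]).localTamagawaNumber ℤ_[q] = c :=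
    Additive.IntModelTam.localTamagawaNumber_padic_eq_of_intModel_of_tamLocal hI0 q hTq hT hvals
  have hI : padicValNat 3 (AddSubgroup.zmultiples P).index ≤ padicValNat 3
      (((⟨a1, a2, a3, a4, a6⟩ : WeierstrassCurve ℚ).baseChange ℚ_[q]).localTamagawaNumber ℤ_[q]) := hcq ▸ hv.trans hw
  exact bsdp_of_carrierNeCertificate_level_of_mult hJ hMcU hGZK hKo hrec hD36 hlev _ 3 hK hD3 hD4 hH hP hnt
    (by decide) hmult hρ q hqN hq3 hI hr hs hvs

/-- **Bucket A, `p = 3 ∥ N` (MULTIPLICATIVE at `3`), carrier `q ≠ 3` ADDITIVE of type `IV` / `IV*` (`c_q = 3`):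
as `bsdp_of_jetRowA3_tam_min` with the Tamagawa half from an EXACT stage-2 certificate `F : TamX`** (Tate's
algorithm Steps 5 / 8; bridge `Additive.IntModelTam.localTamagawaNumber_padic_eq_of_intModel_of_tamX`),
`w ≤ ord₃ F.c`. CONDITIONAL on every binder; per pair. [cite: Jetchev2008, Cor. 1.5 (p. 812)]
[cite: Serre1972, §2.4 Prop. 15 and §5.2 (iii)] [cite: SilvermanATAEC1994, IV.9.4 Steps 5 and 8]
[cite: Wuthrich2014, Lemma 20 (p. 399)] [cite: Miller2011LMS, Def. 1.1] -/
theorem bsdp_of_jetRowA3_tamX_min (a1 a2 a3 a4 a6 : ℤ)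
    (hmin : (⟨a1, a2, a3, a4, a6⟩ : WeierstrassCurve ℚ).IsGloballyMinimal)
    (h3Δ : (3 : ℤ) ∣ (⟨a1, a2, a3, a4, a6⟩ : WeierstrassCurve ℤ).Δ)
    (h3c₄ : ¬ (3 : ℤ) ∣ (⟨a1, a2, a3, a4, a6⟩ : WeierstrassCurve ℤ).c₄)
    (ℓ₁ ℓ₂ : ℕ) (hℓ₁ : ℓ₁.Prime) (hℓ₂ : ℓ₂.Prime) (h2₁ : ℓ₁ ≠ 2) (h2₂ : ℓ₂ ≠ 2)
    (h3₁ : ℓ₁ ≠ 3) (h3₂ : ℓ₂ ≠ 3)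
    (hΔ₁ : ¬ (ℓ₁ : ℤ) ∣ discOf [a1, a2, a3, a4, a6]) (hΔ₂ : ¬ (ℓ₂ : ℤ) ∣ discOf [a1, a2, a3, a4, a6])
    {n₁ n₂ : ℕ} (hc₁ : countPoints [a1, a2, a3, a4, a6] ℓ₁ = n₁)
    (hc₂ : countPoints [a1, a2, a3, a4, a6] ℓ₂ = n₂)
    (hirr : ∀ t : ZMod 3, t ^ 2 - (((ℓ₁ : ℤ) + 1 - n₁ : ℤ) : ZMod 3) * t + ℓ₁ ≠ 0)
    (hdet₂ : (ℓ₂ : ZMod 3) = 1) (htr₂ : (((ℓ₂ : ℤ) + 1 - n₂ : ℤ) : ZMod 3) = 2) (hsq : ¬ 9 ∣ n₂)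
    (q : ℕ) (hq : q.Prime) (F : TamX) (hFq : F.p = q) (hF : F.check ⟨a1, a2, a3, a4, a6⟩ = true)
    {w : ℕ} (hw : w ≤ padicValNat 3 F.c) (hq3 : q ≠ 3)
    (hJ : JetchevDivisibilityCarrierNe)
    (hMcU : McCallum1991_padicValNat_card_sha_primary_add_le_of_globalDivisibility)
    (hGZK : rank_eq_analyticRank_of_analyticRank_le_one)
    (hKo : ∀ (N : ℕ) [NeZero N] (W : WeierstrassCurve ℚ) (K : Type) [Field K] [NumberField K], kolyvagin N W K)
    (hrec : ∀ (N : ℕ) [NeZero N] (W : WeierstrassCurve ℚ) (K : Type) [Field K] [NumberField K],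
      heegnerPointOfConductor_one_galoisConj N W K)
    (hD36 : ∀ (N : ℕ) [NeZero N] (W : WeierstrassCurve ℚ) (K : Type) [Field K] [NumberField K],
      phi_heegnerTau_mem_singularModuliField N W K)
    (hlev : ∀ {N : ℕ} [NeZero N], IsNewformOf.level_eq_conductorNorm (N := N))
    (W : WeierstrassCurve ℚ) (hW : W = ⟨a1, a2, a3, a4, a6⟩)
    {N : ℕ} [NeZero N] {K : Type} [Field K] [NumberField K] (hK : IsImaginaryQuadratic K)
    (hD3 : NumberField.discr K ≠ -3) (hD4 : NumberField.discr K ≠ -4)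
    (hH : SatisfiesHeegnerHypothesis N K) {P : (W.baseChange K).toAffine.Point}
    (hP : IsHeegnerPoint N W K P) (hnt : ¬ IsOfFinAddOrder P) (hqN : q ∣ N)
    (hv : padicValNat 3 (AddSubgroup.zmultiples P).index ≤ w)
    (hr : W.analyticRank ≤ 1) {s : ℚ} (hs : shaAn W = (s : ℂ)) (hvs : padicValRat 3 s = 0) :
    BSDp W 3 := by
  subst hW
  have h0 : discOf [a1, a2, a3, a4, a6] ≠ 0 := fun h ↦ hΔ₁ (by rw [h]; exact dvd_zero _)
  haveI hE : (⟨a1, a2, a3, a4, a6⟩ : WeierstrassCurve ℚ).IsElliptic :=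
    X11b.isElliptic_of_discOf_ne_zero a1 a2 a3 a4 a6 h0
  haveI := hmin
  haveI : Fact (Nat.Prime 3) := ⟨by norm_num⟩
  haveI : Fact (Nat.Prime q) := ⟨hq⟩
  have hI0 : integralModelInt (⟨a1, a2, a3, a4, a6⟩ : WeierstrassCurve ℚ) = ⟨a1, a2, a3, a4, a6⟩ :=
    integralModelInt_eq_of_map_eq _ (map_mk_int a1 a2 a3 a4 a6)
  have hρ : Surj (⟨a1, a2, a3, a4, a6⟩ : WeierstrassCurve ℚ) 3 :=
    Supersingular.surj_three_of_ainvs_of_irr_of_order a1 a2 a3 a4 a6 hmin ℓ₁ ℓ₂ hℓ₁ hℓ₂ h2₁ h2₂ h3₁ h3₂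
      hΔ₁ hΔ₂ hc₁ hc₂ hirr hdet₂ htr₂ hsq
  have hmult : (⟨a1, a2, a3, a4, a6⟩ : WeierstrassCurve ℚ).HasMultiplicativeReductionAtPrime 3 :=
    hasMultiplicativeReductionAtPrime_of_intModel hI0 3 h3Δ h3c₄
  -- the Tamagawa half in the kernel: `c_q(W/ℚ_q) = F.c` (exact IV / IV* certificate)
  have hcq : ((⟨a1, a2, a3, a4, a6⟩ : WeierstrassCurve ℚ).baseChange ℚ_[q]).localTamagawaNumber ℤ_[q] = F.c :=
    Additive.IntModelTam.localTamagawaNumber_padic_eq_of_intModel_of_tamX hI0 q hFq hF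
  have hI : padicValNat 3 (AddSubgroup.zmultiples P).index ≤ padicValNat 3
      (((⟨a1, a2, a3, a4, a6⟩ : WeierstrassCurve ℚ).baseChange ℚ_[q]).localTamagawaNumber ℤ_[q]) := hcq ▸ hv.trans hw
  exact bsdp_of_carrierNeCertificate_level_of_mult hJ hMcU hGZK hKo hrec hD36 hlev _ 3 hK hD3 hD4 hH hP hnt
    (by decide) hmult hρ q hqN hq3 hI hr hs hvs

/-- **Bucket B, `p = 3` the carrier itself (`3 ∥ N`, split `I_{3k}`): `BSD(E,3)` for a literal integer model from
the two-engine HEEGNER-INDEX line `ord₃ [E(K):ℤP] ≤ w` through the bucket-B reading binder, with `ρ̄_{E,3}` ONTO,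
`3` multiplicative and `w ≤ ord₃ c₃(E)` CHECKED IN THE KERNEL** (`TamLocal` at `3`). Inputs and displayed binders
as in `bsdp_of_jetRowA3_tam_min` with `hJ : JetchevDivisibilityCarrierMult` and no `q`; output via
`JET.bsdp_of_carrierMultCertificate_level_of_surj`. CONDITIONAL on every binder; per pair.
[cite: Jetchev2008, Cor. 1.5 (p. 812)] [cite: Serre1972, §2.4 Prop. 15 and §5.2 (iii)]
[cite: SilvermanAEC2009, VII.5 Prop. 5.1(b)] [cite: SilvermanATAEC1994, IV.9.4] [cite: Wuthrich2014, Lemma 20 (p. 399)] -/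
theorem bsdp_of_jetRowB3_tam_min (a1 a2 a3 a4 a6 : ℤ)
    (hmin : (⟨a1, a2, a3, a4, a6⟩ : WeierstrassCurve ℚ).IsGloballyMinimal)
    (h3Δ : (3 : ℤ) ∣ (⟨a1, a2, a3, a4, a6⟩ : WeierstrassCurve ℤ).Δ)
    (h3c₄ : ¬ (3 : ℤ) ∣ (⟨a1, a2, a3, a4, a6⟩ : WeierstrassCurve ℤ).c₄)
    (ℓ₁ ℓ₂ : ℕ) (hℓ₁ : ℓ₁.Prime) (hℓ₂ : ℓ₂.Prime) (h2₁ : ℓ₁ ≠ 2) (h2₂ : ℓ₂ ≠ 2)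
    (h3₁ : ℓ₁ ≠ 3) (h3₂ : ℓ₂ ≠ 3)
    (hΔ₁ : ¬ (ℓ₁ : ℤ) ∣ discOf [a1, a2, a3, a4, a6]) (hΔ₂ : ¬ (ℓ₂ : ℤ) ∣ discOf [a1, a2, a3, a4, a6])
    {n₁ n₂ : ℕ} (hc₁ : countPoints [a1, a2, a3, a4, a6] ℓ₁ = n₁)
    (hc₂ : countPoints [a1, a2, a3, a4, a6] ℓ₂ = n₂)
    (hirr : ∀ t : ZMod 3, t ^ 2 - (((ℓ₁ : ℤ) + 1 - n₁ : ℤ) : ZMod 3) * t + ℓ₁ ≠ 0)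
    (hdet₂ : (ℓ₂ : ZMod 3) = 1) (htr₂ : (((ℓ₂ : ℤ) + 1 - n₂ : ℤ) : ZMod 3) = 2) (hsq : ¬ 9 ∣ n₂)
    (T : TamLocal) (hT3 : T.p = 3) (hT : T.check ⟨a1, a2, a3, a4, a6⟩ = true)
    {c : ℕ} (hvals : T.vals = [c]) {w : ℕ} (hw : w ≤ padicValNat 3 c)
    (hJ : JetchevDivisibilityCarrierMult)
    (hMcU : McCallum1991_padicValNat_card_sha_primary_add_le_of_globalDivisibility)
    (hGZK : rank_eq_analyticRank_of_analyticRank_le_one)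
    (hKo : ∀ (N : ℕ) [NeZero N] (W : WeierstrassCurve ℚ) (K : Type) [Field K] [NumberField K], kolyvagin N W K)
    (hrec : ∀ (N : ℕ) [NeZero N] (W : WeierstrassCurve ℚ) (K : Type) [Field K] [NumberField K],
      heegnerPointOfConductor_one_galoisConj N W K)
    (hD36 : ∀ (N : ℕ) [NeZero N] (W : WeierstrassCurve ℚ) (K : Type) [Field K] [NumberField K],
      phi_heegnerTau_mem_singularModuliField N W K)
    (hlev : ∀ {N : ℕ} [NeZero N], IsNewformOf.level_eq_conductorNorm (N := N))
    (W : WeierstrassCurve ℚ) (hW : W = ⟨a1, a2, a3, a4, a6⟩)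
    {N : ℕ} [NeZero N] {K : Type} [Field K] [NumberField K] (hK : IsImaginaryQuadratic K)
    (hD3 : NumberField.discr K ≠ -3) (hD4 : NumberField.discr K ≠ -4)
    (hH : SatisfiesHeegnerHypothesis N K) {P : (W.baseChange K).toAffine.Point}
    (hP : IsHeegnerPoint N W K P) (hnt : ¬ IsOfFinAddOrder P)
    (hv : padicValNat 3 (AddSubgroup.zmultiples P).index ≤ w)
    (hr : W.analyticRank ≤ 1) {s : ℚ} (hs : shaAn W = (s : ℂ)) (hvs : padicValRat 3 s = 0) :
    BSDp W 3 := by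
  subst hW
  have h0 : discOf [a1, a2, a3, a4, a6] ≠ 0 := fun h ↦ hΔ₁ (by rw [h]; exact dvd_zero _)
  haveI hE : (⟨a1, a2, a3, a4, a6⟩ : WeierstrassCurve ℚ).IsElliptic :=
    X11b.isElliptic_of_discOf_ne_zero a1 a2 a3 a4 a6 h0
  haveI := hmin
  haveI : Fact (Nat.Prime 3) := ⟨by norm_num⟩
  have hI0 : integralModelInt (⟨a1, a2, a3, a4, a6⟩ : WeierstrassCurve ℚ) = ⟨a1, a2, a3, a4, a6⟩ :=
    integralModelInt_eq_of_map_eq _ (map_mk_int a1 a2 a3 a4 a6)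
  have hρ : Surj (⟨a1, a2, a3, a4, a6⟩ : WeierstrassCurve ℚ) 3 :=
    Supersingular.surj_three_of_ainvs_of_irr_of_order a1 a2 a3 a4 a6 hmin ℓ₁ ℓ₂ hℓ₁ hℓ₂ h2₁ h2₂ h3₁ h3₂
      hΔ₁ hΔ₂ hc₁ hc₂ hirr hdet₂ htr₂ hsq
  have hmult : (⟨a1, a2, a3, a4, a6⟩ : WeierstrassCurve ℚ).HasMultiplicativeReductionAtPrime 3 :=
    hasMultiplicativeReductionAtPrime_of_intModel hI0 3 h3Δ h3c₄
  -- the Tamagawa half in the kernel: `c₃(W/ℚ₃) = c`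
  have hc3 : ((⟨a1, a2, a3, a4, a6⟩ : WeierstrassCurve ℚ).baseChange ℚ_[3]).localTamagawaNumber ℤ_[3] = c :=
    Additive.IntModelTam.localTamagawaNumber_padic_eq_of_intModel_of_tamLocal hI0 3 hT3 hT hvals
  have hI : padicValNat 3 (AddSubgroup.zmultiples P).index ≤ padicValNat 3
      (((⟨a1, a2, a3, a4, a6⟩ : WeierstrassCurve ℚ).baseChange ℚ_[3]).localTamagawaNumber ℤ_[3]) := hc3 ▸ hv.trans hw
  exact bsdp_of_carrierMultCertificate_level_of_surj hJ hMcU hGZK hKo hrec hD36 hlev _ 3 hK hD3 hD4 hH hP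
    hnt (by decide) hmult hρ hI hr hs hvs

end Summit.BirchSwinnertonDyer.Rank1Residual.JET

end
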